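import Mathlib
import HarnessLib
import Literature.Geometry.DiscreteGeometry.BondGraph
import Literature.Geometry.DiscreteGeometry.KissingPatterns
import Summits.AtomisticToContinuum.Crystallization.Theorems.PricedLinkCensusSoftLayerPropagationStubShadowTransition
import Summits.AtomisticToContinuum.Crystallization.Theorems.PricedLinkCensusSoftLayerPropagationHXPattern

/-!
# The far apex of a coned square (crux `SoftLayerPropagation`, line `Sketch`, stubs `develop_HX_fcc` / `develop_HX_hcp`)

Route `PricedLinkCensus`, crux `SoftLayerPropagation` (stmt-AtomisticToContinuum-14233), line
`Sketch`.  Helper file shared by the two local no-merge stubs: the FAR APEX LEMMA `hx_far_apex`.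

Setting: a site `x` of positive scale whose neighbours all carry exact labelled charts (pattern
`P ∈ {FCC, HCP}`, linear isometry, labels `m` with the four clauses of `stub_chartAssembly`), and an
induced `4`-cycle `p_u ~ p_a ~ p_k ~ p_b ~ p_u` of the pattern of `x` (a square face of the
cuboctahedron / anticuboctahedron, `pattern_cycle_four`).  Claim: some site `z ≠ x`, not bonded to
`x`, is bonded to all four of `m p_u, m p_a, m p_k, m p_b` — the far apex of the octahedron on the
square, as seen from `x`.

Proof (exact, no metric estimates).  Read the square in the chart of `k = m p_k` (labels `r`):
`r_a ~ r_x ~ r_b` and, by the transition lemma `shadow_transition` for the bond `{x, k}`,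
`|r_a − r_b|² = |p_a − p_b|² = 2`; the fourth corner `r_z = r_a + r_b − r_x` of that square of the
pattern of `k` (`pattern_fourth_corner`) labels a site `z ~ k, a, b` with `z ≁ x`, `z ≠ x`.
Symmetrically the chart of `u` produces `z' ~ u, a, b`.  In the chart of `a` (labels `o`) both
`o_z` and `o_z'` are at squared distance `2` from `o_x` (transitions along `{k, a}` and `{u, a}`),
`o_z ~ o_k`, `o_z' ~ o_u`, and `o_u ~ o_x ~ o_k` with `|o_u − o_k|² = 2` (transition along
`{x, a}`); the table `pattern_two_candidates` then gives `o_z ~ o_u` or `o_z' ~ o_k`, i.e. `z ~ u`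
(and `z` is the apex) or `z' ~ k` (and `z'` is).  All `[folklore]`.
-/

noncomputable section

namespace Summit.AtomisticToContinuum.Crystallization.Theorems

open Literature.Geometry.DiscreteGeometry

/-- Squared distances of labels are preserved by a linear isometry of label differences:
if `L q₁ = q₁' − c` and `L q₂ = q₂' − c` then `dist q₁' q₂' ^ 2 = dist q₁ q₂ ^ 2`. [folklore] -/
theorem dist_sq_eq_of_isometry_labels (L : EuclideanSpace ℝ (Fin 3) →ₗᵢ[ℝ] EuclideanSpace ℝ (Fin 3))
    {q₁ q₂ q₁' q₂' c : EuclideanSpace ℝ (Fin 3)} (h₁ : L q₁ = q₁' - c) (h₂ : L q₂ = q₂' - c) :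
    dist q₁' q₂' ^ 2 = dist q₁ q₂ ^ 2 := by
  have : q₁' - q₂' = L (q₁ - q₂) := by rw [map_sub, h₁, h₂]; abel
  rw [dist_eq_norm, dist_eq_norm, this, LinearIsometry.norm_map]

/-- **The far apex lemma (`hx_far_apex`).**  At a site `x` of positive scale all of whose sites within
`5/2 · nn_x` carry exact labelled charts, with a chart `(P, A, m)` at `x` (`P ∈ {FCC, HCP}`): for every
induced `4`-cycle `p_u ~ p_a ~ p_k ~ p_b ~ p_u` of `P` (`p_u, p_k` and `p_a, p_b` distinct
non-contacts) there is a site `z` bonded to `m p_u`, `m p_a`, `m p_k`, `m p_b`, not bonded to `x` and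
different from `x`. [folklore] -/
theorem hx_far_apex : ∀ η : ℝ, 0 ≤ η → η ≤ 1 →
    ∀ (N : ℕ) (y : Fin N → EuclideanSpace ℝ (Fin 3)) (x : Fin N),
      0 < Literature.Geometry.DiscreteGeometry.nearestDist y x →
      (∀ j : Fin N, dist (y x) (y j) ≤ 5 / 2 * Literature.Geometry.DiscreteGeometry.nearestDist y x →
        ∃ (P : Finset (EuclideanSpace ℝ (Fin 3)))
          (A : EuclideanSpace ℝ (Fin 3) →ₗᵢ[ℝ] EuclideanSpace ℝ (Fin 3))
          (m : EuclideanSpace ℝ (Fin 3) → Fin N),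
          (P = Literature.Geometry.DiscreteGeometry.fccKissingPattern ∨
            P = Literature.Geometry.DiscreteGeometry.hcpKissingPattern) ∧
          (∀ p ∈ P, (Literature.Geometry.DiscreteGeometry.bondGraph η y).Adj j (m p) ∧
            dist (y (m p)) (y j + Literature.Geometry.DiscreteGeometry.nearestDist y j • A p) ≤
              Literature.Geometry.DiscreteGeometry.nearestDist y j / 4) ∧
          (∀ p ∈ P, ∀ q ∈ P, m p = m q → p = q) ∧
          (∀ p ∈ P, ∀ q ∈ P,
            ((Literature.Geometry.DiscreteGeometry.bondGraph η y).Adj (m p) (m q) ↔ dist p q = 1)) ∧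
          (∀ l, (Literature.Geometry.DiscreteGeometry.bondGraph η y).Adj j l → ∃ p ∈ P, m p = l)) →
      ∀ (P : Finset (EuclideanSpace ℝ (Fin 3)))
        (A : EuclideanSpace ℝ (Fin 3) →ₗᵢ[ℝ] EuclideanSpace ℝ (Fin 3)) (m : EuclideanSpace ℝ (Fin 3) → Fin N),
        (P = Literature.Geometry.DiscreteGeometry.fccKissingPattern ∨
          P = Literature.Geometry.DiscreteGeometry.hcpKissingPattern) →
        (∀ p ∈ P, (Literature.Geometry.DiscreteGeometry.bondGraph η y).Adj x (m p) ∧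
          dist (y (m p)) (y x + Literature.Geometry.DiscreteGeometry.nearestDist y x • A p) ≤
            Literature.Geometry.DiscreteGeometry.nearestDist y x / 4) →
        (∀ p ∈ P, ∀ q ∈ P, m p = m q → p = q) →
        (∀ p ∈ P, ∀ q ∈ P,
          ((Literature.Geometry.DiscreteGeometry.bondGraph η y).Adj (m p) (m q) ↔ dist p q = 1)) →
        (∀ l, (Literature.Geometry.DiscreteGeometry.bondGraph η y).Adj x l → ∃ p ∈ P, m p = l) →
      ∀ pu ∈ P, ∀ pa ∈ P, ∀ pk ∈ P, ∀ pb ∈ P,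
        dist pu pa = 1 → dist pa pk = 1 → dist pk pb = 1 → dist pb pu = 1 →
        pu ≠ pk → dist pu pk ≠ 1 → pa ≠ pb → dist pa pb ≠ 1 →
      ∃ z : Fin N, (Literature.Geometry.DiscreteGeometry.bondGraph η y).Adj (m pu) z ∧
        (Literature.Geometry.DiscreteGeometry.bondGraph η y).Adj (m pa) z ∧
        (Literature.Geometry.DiscreteGeometry.bondGraph η y).Adj (m pk) z ∧
        (Literature.Geometry.DiscreteGeometry.bondGraph η y).Adj (m pb) z ∧
        ¬ (Literature.Geometry.DiscreteGeometry.bondGraph η y).Adj x z ∧ x ≠ z := by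
  intro η hη0 hη1 N y x hnn charts P A m hP C2 C3 C4 C5 pu hpu pa hpa pk hpk pb hpb
    dua dak dkb dbu nuk duk nab dab
  have hη : (0 : ℝ) ≤ 1 + η := by linarith
  -- the four sites and their bonds
  set u := m pu with hu_def
  set a := m pa with ha_def
  set k := m pk with hk_def
  set b := m pb with hb_def
  have hxu : (bondGraph η y).Adj x u := (C2 pu hpu).1
  have hxa : (bondGraph η y).Adj x a := (C2 pa hpa).1
  have hxk : (bondGraph η y).Adj x k := (C2 pk hpk).1
  have hxb : (bondGraph η y).Adj x b := (C2 pb hpb).1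
  have hua : (bondGraph η y).Adj u a := (C4 pu hpu pa hpa).2 dua
  have hak : (bondGraph η y).Adj a k := (C4 pa hpa pk hpk).2 dak
  have hkb : (bondGraph η y).Adj k b := (C4 pk hpk pb hpb).2 dkb
  have hbu : (bondGraph η y).Adj b u := (C4 pb hpb pu hpu).2 dbu
  -- the square has diagonals of squared length `2`
  obtain ⟨duk2, dab2⟩ := pattern_cycle_four hP hpu hpa hpk hpb dua dak dkb dbu nuk duk nab dab
  -- charts at the neighbours of `x`
  have near : ∀ {l : Fin N}, (bondGraph η y).Adj x l → dist (y x) (y l) ≤ 5 / 2 * nearestDist y x := by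
    intro l hl
    refine (dist_le_of_adj hη hl).trans ?_
    exact mul_le_mul_of_nonneg_right (by linarith) (nearestDist_nonneg y x)
  have posk : 0 < nearestDist y k := by
    have h := nearestDist_le_mul_of_adj hη hxk
    by_contra hneg
    push Not at hneg
    nlinarith
  have posu : 0 < nearestDist y u := by
    have h := nearestDist_le_mul_of_adj hη hxu
    by_contra hneg
    push Not at hneg
    nlinarith
  obtain ⟨Pk, Ak, mk, hPk, K2, K3, K4, K5⟩ := charts k (near hxk)
  obtain ⟨Pu, Au, mu, hPu, U2, U3, U4, U5⟩ := charts u (near hxu)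
  obtain ⟨Pa, Aa, ma, hPa, A2, A3, A4, A5⟩ := charts a (near hxa)
  /- Step 1: the candidate `z` from the chart of `k`. -/
  obtain ⟨rx, hrx, mrx⟩ := K5 x hxk.symm
  obtain ⟨ra, hra, mra⟩ := K5 a hak.symm
  obtain ⟨rb, hrb, mrb⟩ := K5 b hkb
  have drxa : dist rx ra = 1 := (K4 rx hrx ra hra).1 (by rw [mrx, mra]; exact hxa)
  have drxb : dist rx rb = 1 := (K4 rx hrx rb hrb).1 (by rw [mrx, mrb]; exact hxb)
  obtain ⟨L₁, hL₁⟩ := shadow_transition η N y x k hnn hxk P A m hP C2 C3 C4 C5 Pk Ak mk hPk K2 K3 K4 K5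
  obtain ⟨-, hL₁'⟩ := hL₁ pk hpk rx hrx rfl mrx
  have drab : dist ra rb ^ 2 = 2 := by
    rw [dist_sq_eq_of_isometry_labels L₁ (hL₁' pa hpa ra hra mra.symm) (hL₁' pb hpb rb hrb mrb.symm)]
    exact dab2
  obtain ⟨hrz, dza, dzb, dzx2, dzx, nzx⟩ := pattern_fourth_corner hPk hrx hra hrb drxa drxb drab
  set rz := ra + rb - rx with hrz_def
  set z := mk rz with hz_def
  have hkz : (bondGraph η y).Adj k z := (K2 rz hrz).1
  have hza : (bondGraph η y).Adj z a := by rw [← mra]; exact (K4 rz hrz ra hra).2 dza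
  have hzb : (bondGraph η y).Adj z b := by rw [← mrb]; exact (K4 rz hrz rb hrb).2 dzb
  have hzx : ¬ (bondGraph η y).Adj z x := by rw [← mrx, hz_def, K4 rz hrz rx hrx]; exact dzx
  have nezx : z ≠ x := by
    intro h
    exact nzx (K3 rz hrz rx hrx (h.trans mrx.symm))
  /- Step 2: the candidate `z'` from the chart of `u`. -/
  obtain ⟨qx, hqx, mqx⟩ := U5 x hxu.symm
  obtain ⟨qa, hqa, mqa⟩ := U5 a hua
  obtain ⟨qb, hqb, mqb⟩ := U5 b hbu.symm
  have dqxa : dist qx qa = 1 := (U4 qx hqx qa hqa).1 (by rw [mqx, mqa]; exact hxa)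
  have dqxb : dist qx qb = 1 := (U4 qx hqx qb hqb).1 (by rw [mqx, mqb]; exact hxb)
  obtain ⟨L₂, hL₂⟩ := shadow_transition η N y x u hnn hxu P A m hP C2 C3 C4 C5 Pu Au mu hPu U2 U3 U4 U5
  obtain ⟨-, hL₂'⟩ := hL₂ pu hpu qx hqx rfl mqx
  have dqab : dist qa qb ^ 2 = 2 := by
    rw [dist_sq_eq_of_isometry_labels L₂ (hL₂' pa hpa qa hqa mqa.symm) (hL₂' pb hpb qb hqb mqb.symm)]
    exact dab2
  obtain ⟨hqz, dz'a, dz'b, dz'x2, dz'x, nz'x⟩ := pattern_fourth_corner hPu hqx hqa hqb dqxa dqxb dqab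
  set qz := qa + qb - qx with hqz_def
  set z' := mu qz with hz'_def
  have huz' : (bondGraph η y).Adj u z' := (U2 qz hqz).1
  have hz'a : (bondGraph η y).Adj z' a := by rw [← mqa]; exact (U4 qz hqz qa hqa).2 dz'a
  have hz'b : (bondGraph η y).Adj z' b := by rw [← mqb]; exact (U4 qz hqz qb hqb).2 dz'b
  have hz'x : ¬ (bondGraph η y).Adj z' x := by rw [← mqx, hz'_def, U4 qz hqz qx hqx]; exact dz'x
  have nez'x : z' ≠ x := by
    intro h
    exact nz'x (U3 qz hqz qx hqx (h.trans mqx.symm))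
  /- Step 3: compare the two candidates in the chart of `a`. -/
  obtain ⟨ox, hox, mox⟩ := A5 x hxa.symm
  obtain ⟨ou, hou, mou⟩ := A5 u hua.symm
  obtain ⟨ok, hok, mok⟩ := A5 k hak
  obtain ⟨oz, hoz, moz⟩ := A5 z hza.symm
  obtain ⟨oz', hoz', moz'⟩ := A5 z' hz'a.symm
  have doux : dist ou ox = 1 := (A4 ou hou ox hox).1 (by rw [mou, mox]; exact hxu.symm)
  have dokx : dist ok ox = 1 := (A4 ok hok ox hox).1 (by rw [mok, mox]; exact hxk.symm)
  have dozk : dist oz ok = 1 := (A4 oz hoz ok hok).1 (by rw [moz, mok]; exact hkz.symm)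
  have doz'u : dist oz' ou = 1 := (A4 oz' hoz' ou hou).1 (by rw [moz', mou]; exact huz'.symm)
  -- `|o_u − o_k|² = 2` by the transition along `{x, a}`
  obtain ⟨L₃, hL₃⟩ := shadow_transition η N y x a hnn hxa P A m hP C2 C3 C4 C5 Pa Aa ma hPa A2 A3 A4 A5
  obtain ⟨-, hL₃'⟩ := hL₃ pa hpa ox hox rfl mox
  have douk : dist ou ok ^ 2 = 2 := by
    rw [dist_sq_eq_of_isometry_labels L₃ (hL₃' pu hpu ou hou mou.symm) (hL₃' pk hpk ok hok mok.symm)]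
    exact duk2
  -- `|o_z − o_x|² = 2` by the transition along `{k, a}`
  obtain ⟨L₄, hL₄⟩ := shadow_transition η N y k a posk hak.symm Pk Ak mk hPk K2 K3 K4 K5 Pa Aa ma hPa
    A2 A3 A4 A5
  obtain ⟨-, hL₄'⟩ := hL₄ ra hra ok hok mra mok
  have dozx : dist oz ox ^ 2 = 2 := by
    rw [dist_sq_eq_of_isometry_labels L₄ (hL₄' rz hrz oz hoz moz.symm) (hL₄' rx hrx ox hox (mrx.trans mox.symm))]
    exact dzx2
  -- `|o_z' − o_x|² = 2` by the transition along `{u, a}`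
  obtain ⟨L₅, hL₅⟩ := shadow_transition η N y u a posu hua Pu Au mu hPu U2 U3 U4 U5 Pa Aa ma hPa
    A2 A3 A4 A5
  obtain ⟨-, hL₅'⟩ := hL₅ qa hqa ou hou mqa mou
  have doz'x : dist oz' ox ^ 2 = 2 := by
    rw [dist_sq_eq_of_isometry_labels L₅ (hL₅' qz hqz oz' hoz' moz'.symm) (hL₅' qx hqx ox hox (mqx.trans mox.symm))]
    exact dz'x2
  -- the table
  rcases pattern_two_candidates hPa hox hou hok hoz hoz' doux dokx douk dozx dozk doz'x doz'u with h | h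
  · have hzu : (bondGraph η y).Adj z u := by rw [← moz, ← mou]; exact (A4 oz hoz ou hou).2 h
    exact ⟨z, hzu.symm, hza.symm, hkz, hzb.symm, fun h' => hzx h'.symm, fun h' => nezx h'.symm⟩
  · have hz'k : (bondGraph η y).Adj z' k := by rw [← moz', ← mok]; exact (A4 oz' hoz' ok hok).2 h
    exact ⟨z', huz', hz'a.symm, hz'k.symm, hz'b.symm, fun h' => hz'x h'.symm, fun h' => nez'x h'.symm⟩

end Summit.AtomisticToContinuum.Crystallization.Theorems

end
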